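import Summits.ResolutionOfSingularities.ResolutionOfSingularities.Theorems.FrobeniusLadderFRationalResolutionPrimaryCentreEtale
import HarnessLib

/-!
# Crux `FrobeniusLadder.FRationalResolution` (stmt-ResolutionOfSingularities-15317), line `redirect`,
# stub `stub_diagonalizableQuotientResolution` — the DESCENDED PRIMARY PIECE with locally regular blow-up, ring form over an
# ARBITRARY Noetherian base (step R2 of the Galois route: apply it to `B ⊗_K K' → C ⊗_K K'` at a trivial-residue point)

`…PrimaryCentreEtale.hloc_of_primaryBlowup_flat_chart` (✓) runs E-k (`…CentreDescent`) and the fpqc descent of the regular blow-up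
(`…ChartTransfer`, `…ChartHloc`) all the way to the scheme-side datum `hloc`, and for that needs the base `B` to be the coordinate ring
of an affine open of `X` (a domain, regular off `𝔭`). The Galois route needs the INTERMEDIATE, purely ring-theoretic output on the base
`B' = B ⊗_K K'` (not a domain, several singular points over `𝔭`): a `𝔭'`-primary ideal of the base whose blow-up is regular on a basic
open around `𝔭'` — precisely the input `(I, n, g)` of `…GaloisBaseChangeRegular.hloc_of_decomposition_stable_piece'`.

* **`exists_descended_primary_piece`** — `B` Noetherian, `C` a flat finitely presented `B`-algebra, `𝔔 ⊆ C` maximal over the maximal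
  `𝔭` with TRIVIAL residue extension and `𝔭 C_𝔔 = 𝔔 C_𝔔` (unramified at `𝔔`), `J` with `𝔔ⁿ ⊆ J ⊆ 𝔔` and `Bl_J(Spec C)` regular
  ⇒ `∃ I, 𝔭ⁿ ⊆ I ⊆ 𝔭` and `∃ h ∉ 𝔭` with `Bl_{I B_h}(Spec B_h)` regular.

Honest label: plumbing (no stub closed by name): `…FibreReduced` + `…CentreDescent` + `…FlatCoverLocalization` + `…BlowupFlatCriteria`,
re-assembled without the domain / isolated-point hypotheses. No definitions, no named facts, no sorry.
[cite: StacksProject, Tag 00UW; Tag 02NS] [cite: GortzWedhorn2020, Prop. 13.91 (2)]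
-/

noncomputable section

-- single-problem summit: the doubled namespace component is forced
set_option linter.dupNamespace false

open CategoryTheory AlgebraicGeometry TopologicalSpace
open Literature.AlgebraicGeometry.Resolution
open Summit.ResolutionOfSingularities.ResolutionOfSingularities.Theorems.FRationalResolution

namespace Summit.ResolutionOfSingularities.ResolutionOfSingularities.Theorems.FRationalResolution.DescendedPrimaryPiece

open BlowupFlatCriteria FlatCoverLocalization

universe u

/-- **The descended primary piece with locally regular blow-up.** Let `B` be Noetherian, `C` a flat finitely presented `B`-algebra,
`𝔭 ⊆ B` maximal, `𝔔 ⊆ C` maximal over `𝔭` with trivial residue extension (`every c ≡ some b mod 𝔔`) and `𝔭 C_𝔔 = 𝔪_{C_𝔔}`, and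
`J ⊆ C` with `𝔔ⁿ ⊆ J ⊆ 𝔔` whose blow-up `Bl_J(Spec C)` is regular. Then there is an ideal `I ⊆ B` with `𝔭ⁿ ⊆ I ⊆ 𝔭` and an
`h ∉ 𝔭` such that `Bl_{I B_h}(Spec B_h)` is regular. (`I C_g = J C_g` on a basic open `D(g) ∋ 𝔔` over which `𝔔` is the reduced
fibre of `𝔭`; regularity descends along the flat surjective `Spec C_{g h} → Spec B_h`.) [cite: StacksProject, Tag 00UW; Tag 02NS]
[cite: GortzWedhorn2020, Prop. 13.91 (2)] -/
theorem exists_descended_primary_piece {B C : Type u} [CommRing B] [CommRing C] [Algebra B C] [IsNoetherianRing B]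
    [Module.Flat B C] [Algebra.FinitePresentation B C]
    (𝔭 : Ideal B) [h𝔭 : 𝔭.IsMaximal] (𝔔 : Ideal C) [h𝔔 : 𝔔.IsMaximal] (hover : 𝔭 ≤ 𝔔.comap (algebraMap B C))
    (hres : ∀ c : C, ∃ b : B, c - algebraMap B C b ∈ 𝔔)
    (hunr : 𝔭.map (algebraMap B (Localization.AtPrime 𝔔)) =
      IsLocalRing.maximalIdeal (Localization.AtPrime 𝔔))
    (J : Ideal C) {n : ℕ} (hJ : 𝔔 ^ n ≤ J) (hJ𝔔 : J ≤ 𝔔) (hregJ : Scheme.IsRegular (affineBlowup J)) :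
    ∃ I : Ideal B, 𝔭 ^ n ≤ I ∧ I ≤ 𝔭 ∧
      ∃ h : B, h ∉ 𝔭 ∧ Scheme.IsRegular (affineBlowup (I.map (algebraMap B (Localization.Away h)))) := by
  haveI : Algebra.FiniteType B C := inferInstance
  haveI : IsNoetherianRing C := Algebra.FiniteType.isNoetherianRing B C
  -- over `D(g)` the fibre of `𝔭` is the reduced point `𝔔`
  obtain ⟨g, hg, hle⟩ := FibreReduced.exists_away_fibre_reduced 𝔭 𝔔 hunr
  set Cg := Localization.Away g with hCg
  haveI : Algebra.FinitePresentation B Cg :=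
    haveI := IsLocalization.Away.finitePresentation g (S := Cg)
    Algebra.FinitePresentation.trans B C Cg
  haveI : IsOpenImmersion (Spec.map (CommRingCat.ofHom (algebraMap C Cg))) := IsOpenImmersion.of_isLocalization g
  have halg : algebraMap B Cg = (algebraMap C Cg).comp (algebraMap B C) := IsScalarTower.algebraMap_eq B C _
  -- descend the centre
  obtain ⟨I, hpI, hIp, hIJ⟩ := CentreDescent.exists_descended_centre 𝔭 𝔔 hover hres g hg Cg hle J hJ hJ𝔔
  -- `Bl_{I C_g} = Bl_{J C_g}` is an open piece of `Bl_J`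
  have hregC : Scheme.IsRegular (affineBlowup (I.map (algebraMap B Cg))) := by
    rw [halg, hIJ]
    exact isRegular_affineBlowup_map_of_isOpenImmersion _ J hregJ
  -- `𝔭` lies under `𝔔 C_g`
  have hdisj : Disjoint ((Submonoid.powers g : Submonoid C) : Set C) (𝔔 : Set C) := by
    refine Set.disjoint_left.mpr ?_
    rintro x ⟨m, rfl⟩ hx
    exact hg (h𝔔.isPrime.mem_of_pow_mem m hx)
  haveI hQ'prime : (𝔔.map (algebraMap C Cg)).IsPrime :=
    IsLocalization.isPrime_of_isPrime_disjoint (Submonoid.powers g) _ 𝔔 h𝔔.isPrime hdisj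
  have hcomapQ : 𝔔.comap (algebraMap B C) = 𝔭 :=
    (h𝔭.eq_of_le (Ideal.IsPrime.ne_top inferInstance) hover).symm
  have h𝔭C : (⟨𝔭, h𝔭.isPrime⟩ : PrimeSpectrum B) ∈ Set.range (PrimeSpectrum.comap (algebraMap B Cg)) := by
    have hQQ : (𝔔.map (algebraMap C Cg)).comap (algebraMap C Cg) = 𝔔 :=
      IsLocalization.under_map_of_isPrime_disjoint (Submonoid.powers g) Cg h𝔔.isPrime hdisj
    refine ⟨⟨𝔔.map (algebraMap C Cg), hQ'prime⟩, ?_⟩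
    ext1
    change (𝔔.map (algebraMap C Cg)).comap (algebraMap B Cg) = 𝔭
    rw [halg, ← Ideal.comap_comap, hQQ]
    exact hcomapQ
  -- a basic open `D(h) ∋ 𝔭` inside the (open) image of the flat chart `Spec C_g → Spec B`
  obtain ⟨h, hh𝔭, hsub⟩ := exists_basicOpen_subset_range_comap B Cg ⟨𝔭, h𝔭.isPrime⟩ h𝔭C
  set B' := Localization.Away h with hB'
  set C' := Localization.Away (algebraMap B Cg h) with hC'
  set φ' : B' →+* C' := IsLocalization.Away.map B' C' (algebraMap B Cg) h with hφ'
  set I' : Ideal B' := I.map (algebraMap B B') with hI'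
  haveI : IsNoetherianRing B' := IsLocalization.isNoetherianRing (Submonoid.powers h) B' inferInstance
  have hflat : φ'.Flat := flat_awayMap B Cg (RingHom.flat_algebraMap_iff.mpr inferInstance) h B' C'
  have hsurj : Function.Surjective (PrimeSpectrum.comap φ') := comap_awayMap_surjective B Cg h hsub B' C'
  haveI : IsOpenImmersion (Spec.map (CommRingCat.ofHom (algebraMap Cg C'))) :=
    IsOpenImmersion.of_isLocalization (algebraMap B Cg h)
  have hregC' : Scheme.IsRegular (affineBlowup (I'.map φ')) := by
    have hcomp : φ'.comp (algebraMap B B') = (algebraMap Cg C').comp (algebraMap B Cg) := by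
      rw [hφ', IsLocalization.Away.map, IsLocalization.map_comp]
    rw [hI', Ideal.map_map, hcomp, ← Ideal.map_map]
    exact isRegular_affineBlowup_map_of_isOpenImmersion (algebraMap Cg C') _ hregC
  exact ⟨I, hpI, hIp, h, hh𝔭, isRegular_affineBlowup_of_flat_of_surjective φ' I' hflat hsurj hregC'⟩

end Summit.ResolutionOfSingularities.ResolutionOfSingularities.Theorems.FRationalResolution.DescendedPrimaryPiece

end
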